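import Literature.Probability.LatticeModels.PlaneRotatorTwistInequality
import Literature.Probability.LatticeModels.GinibreBesselBounds
import Literature.Probability.LatticeModels.VillainTorusWormRepresentation
import Mathlib.Analysis.Calculus.SmoothSeries
import HarnessLib

/-!
# The dual formula for the helicity modulus of the plane rotator:
# `(−log Z)''(0) · Z = ∑_{n closed} ∏_a I_{n_a}(J_a) · Φ_s(n)²` — the twist modulus is the mean-square
# flux of the divergence-free integer currents; on `(ℤ/Lℤ)²`, `βΥ_L = ⟨w²⟩` (winding-number variance)

Topic `Literature/Probability/LatticeModels`; pure-proof companion of `PlaneRotatorHelicityModulus.lean`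
(p536677: `BondSystem.twistPartitionFn`, `twistModulus`, differentiability of `Z(t)`) and
`PlaneRotatorTwistInequality.lean` (p539386: the character expansion of the twisted partition function
`coe_twistPartitionFn_eq_tsum`). Everything is PROVED; no definition and no named fact is introduced.

For the plane rotator with real bond couplings `J : ι → ℝ` on a finite bond system and a twist profile
`s : ι → ℝ`, the character expansion writes the twisted partition function as a sum over
divergence-free integer currents `n : ι → ℤ` (`∏_a χ_a^{n_a} = 1`, i.e. `twistChar χ 1 n = 1`):

  `Z(t) = ∑_n W(n) e^{i t Φ_s(n)}`,  `W(n) = [n closed] ∏_a I_{n_a}(J_a)`,  `Φ_s(n) = ∑_a s_a n_a`,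

where `Φ_s(n)` is the **`s`-flux of the current** `n` (on the torus `(ℤ/Lℤ)²` with the twist along `e₁`,
`Φ = ∑_{e₁-bonds} n_b = L ×` the winding number of `n` around the `e₁`-cycle).

## Contents

* §1 Polynomial moments of the Bessel coefficients: `∑_{m ∈ ℤ} I_m(x)(1 + |m|)² < ∞` for `x ≥ 0`
  (`summable_besselI_mul_one_add_natAbs_sq`; tree bound `I_m(x) ≤ (x/2)^m/m! · I_0(x)` and
  `(1 + m)² ≤ 4^m`).
* §2 Fluxes: `|Φ_s(n)| ≤ (∑_a |s_a|) ∏_b (1 + |n_b|)` (private lemmas) and the summable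
  moment majorant `∑_n ∏_a I_{n_a}(|J_a|)(1 + |n_a|)² < ∞` (`summable_prod_besselI_mul_one_add_natAbs_sq`; the flux bounds are private plumbing).
* §3 Dual weights `W(n)`: `|W(n)| ≤ ∏_a I_{n_a}(|J_a|)` and the flux moments
  `∑_n |W(n)| Φ_s(n)² < ∞` (`BondSystem.summable_abs_currentWeight_mul_flux_sq`, any real `J`).
* §4 Termwise differentiation, twice (Mathlib `hasDerivAt_tsum`), of `t ↦ ∑_n W(n) e^{i t Φ_s(n)}`
  (`hasDerivAt_tsum_currentWeight_mul_exp`, `hasDerivAt_tsum_currentWeight_mul_flux_mul_exp`).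
* §5 Identification: `Z(t) = ∑_n W(n) e^{itΦ_s(n)}` (`coe_twistPartitionFn_eq_tsum_exp`, from the
  tree's `coe_twistPartitionFn_eq_tsum`), hence by uniqueness of derivatives
  `Z'(t) = ∑_n W(n) iΦ_s(n) e^{itΦ_s(n)}`, `Z''(t) = ∑_n W(n) (iΦ_s(n))² e^{itΦ_s(n)}`
  (`coe_twistPartitionFnDeriv_eq_tsum`, `coe_twistPartitionFnDeriv2_eq_tsum`),
  `Z''(0) = −∑_n W(n) Φ_s(n)²` (`twistPartitionFnDeriv2_zero_eq_neg_tsum`), and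
  **THE DUAL FORMULA `twistModulus · Z(J) = ∑_n W(n) Φ_s(n)²`**
  (`twistModulus_mul_partitionFnJ_eq_tsum`, any real couplings; with `Z'(0) = 0` of
  `PlaneRotatorTwistInequality.lean`), `twistModulus = (∑_n W(n)Φ_s(n)²)/(∑_n W(n))`
  (`twistModulus_eq_tsum_div_tsum`): for ferromagnetic `J ≥ 0` the helicity modulus is the
  MEAN-SQUARE `s`-FLUX of the dual ensemble `P(n) ∝ W(n)` of divergence-free integer currents (every
  term `W(n)Φ_s(n)² ≥ 0`: the dual reading of the tree's `twistModulus_nonneg`, not restated here).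
* §6 Torus `(ℤ/Lℤ)²`, twist along `e₁`: `βΥ_L(K) · L² · Z_L(K) = ∑_n W(n) (∑_{e₁-bonds} n_b)²`
  (`torusXYStiffness_mul_card_mul_partitionFnJ_eq_tsum`).
* §7 Winding: Kirchhoff's law for closed currents on the torus (`torusXY_kirchhoff`, via the tree's
  `BondSystem.twistChar_bondChar_diffChar_eq_one_iff`), cut independence of the flux
  `w_j(n) = ∑_{v : v₀ = j} n_{(v,e₁)}` through a vertical cut (`torusXY_cutFlux_succ/_eq`),
  `∑_{e₁-bonds} n_b = L · w_j(n)` (`torusXY_sum_dir0_eq_card_mul_cutFlux`), and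
  **`βΥ_L(K) · Z_L(K) = ∑_n W(n) w_j(n)²`** (`torusXYStiffness_mul_partitionFnJ_eq_tsum_winding`): the
  reduced helicity modulus IS the winding-number variance `⟨w²⟩_W` of the dual current ensemble — the
  classical twin of the winding-number estimator of the superfluid density, and the exact object behind
  Fröhlich–Pfister's remark that the twist free energy «is related to the mean energy of a vortex
  winding around the cylinder».

Reading (cell `pub/hubbard-tc`): any «winding statement» about `Υ_L` and any high-temperature statement
`Υ_L → 0` is a statement about `⟨w²⟩_W`; this file puts the dictionary `Υ_L ↔ winding fluctuations of
the dual currents` in the kernel exactly (number-neutral; no size estimate of `⟨w²⟩` is made here).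

## What this is not

A finite-volume identity for the classical plane rotator; no statement about the size of the flux
fluctuations (high- or low-temperature), no vortices, nothing quantum. No number of the cell's tables
consumes it.

## References

* J. Fröhlich, C.-E. Pfister, Comm. Math. Phys. 89 (1983) 303–327, Lemma 3.1 and the Remark after it
  (pp. 307–308: `−π(L,T)` «is related to the mean energy of a vortex winding around the cylinder»).
  [FrohlichPfister1983]
* M. E. Fisher, M. N. Barber, D. Jasnow, Phys. Rev. A 8 (1973) 1111, §II eqs. (2.3)–(2.5).
  [FisherBarberJasnow1973]
* J. Fröhlich, T. Spencer, Comm. Math. Phys. 83 (1982) 411, §2.3 (duality transformation: integer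
  currents). [FrohlichSpencerCMP1982]
* I. Montvay, G. Münster, *Quantum Fields on a Lattice*, CUP 1994, §3.2.7 (3.169)–(3.172).
  [MontvayMunster1994]
* M. Abramowitz, I. Stegun, 9.6.10 (series of `I_ν`). [AbramowitzStegun1964]

Tree: `besselI_natCast_le_pow_div_factorial_mul`, `summable_prod_norm`, `coe_twistPartitionFn_eq_tsum`,
`hasDerivAt_twistPartitionFn(Deriv)`, `hasDerivAt_twistFreeEnergyDeriv(_zero)`,
`twistPartitionFnDeriv_zero_eq_zero`, `integral_ginibreWeight_eq_tsum`,
`BondSystem.twistChar_bondChar_diffChar_eq_one_iff` (Kirchhoff), `torusXYStiffness`. Mathlib: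
`hasDerivAt_tsum`, `HasDerivAt.ofReal_comp`, `HasDerivAt.unique`, `Summable.of_nat_of_neg`,
`ZMod.natCast_zmod_val`.
-/

noncomputable section

open MeasureTheory Finset Filter Complex
open scoped BigOperators Topology Nat

namespace Literature.Probability.LatticeModels

/-! ## §1 Polynomial moments of the Bessel coefficients -/

section Bessel

/-- `(1 + m)² ≤ 4^m`. [folklore] -/
private theorem one_add_sq_le_four_pow (m : ℕ) : (1 + (m : ℝ)) ^ 2 ≤ 4 ^ m := by
  induction m with
  | zero => norm_num
  | succ k ih =>
    have hk : (0 : ℝ) ≤ k := Nat.cast_nonneg k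
    calc (1 + ((k + 1 : ℕ) : ℝ)) ^ 2 = (2 + (k : ℝ)) ^ 2 := by push_cast; ring
      _ ≤ 4 * (1 + (k : ℝ)) ^ 2 := by nlinarith
      _ ≤ 4 * 4 ^ k := by gcongr
      _ = 4 ^ (k + 1) := by ring

/-- **Second moments of the Bessel coefficients**: `∑_{m ∈ ℤ} I_m(x) (1 + |m|)² < ∞` for `x ≥ 0`
(from `I_m(x) ≤ (x/2)^{|m|}/|m|! · I_0(x)` and `(1 + m)² ≤ 4^m`: the summand is at most
`I_0(x) (2x)^{|m|}/|m|!`). [cite: AbramowitzStegun1964, 9.6.10 (series of `I_ν`; termwise comparison)] -/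
theorem summable_besselI_mul_one_add_natAbs_sq {x : ℝ} (hx : 0 ≤ x) :
    Summable fun m : ℤ => besselI m x * (1 + (m.natAbs : ℝ)) ^ 2 := by
  have hI0 : 0 ≤ besselI 0 x := besselI_nonneg hx 0
  have hb : ∀ m : ℕ, besselI (m : ℤ) x * (1 + (m : ℝ)) ^ 2 ≤ besselI 0 x * ((2 * x) ^ m / m !) := by
    intro m
    have h1 := besselI_natCast_le_pow_div_factorial_mul hx m
    have h2 := one_add_sq_le_four_pow m
    have h3 : 0 ≤ (x / 2) ^ m / m ! * besselI 0 x := by positivity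
    calc besselI (m : ℤ) x * (1 + (m : ℝ)) ^ 2 ≤ ((x / 2) ^ m / m ! * besselI 0 x) * 4 ^ m :=
          mul_le_mul h1 h2 (sq_nonneg _) h3
      _ = besselI 0 x * ((2 * x) ^ m / m !) := by
          rw [show (2 * x) ^ m = 4 ^ m * (x / 2) ^ m by rw [← mul_pow]; ring_nf]
          ring
  have hnat : Summable fun m : ℕ => besselI (m : ℤ) x * (1 + (m : ℝ)) ^ 2 :=
    Summable.of_nonneg_of_le (fun m => mul_nonneg (besselI_nonneg hx _) (sq_nonneg _)) hb
      ((Real.summable_pow_div_factorial (2 * x)).mul_left _)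
  refine Summable.of_nat_of_neg ?_ ?_
  · simpa using hnat
  · simpa [besselI_neg_index] using hnat

end Bessel

/-! ## §2 Fluxes of integer currents: bounds -/

section Flux

variable {ι : Type*} [Fintype ι]

/-- `|n_a| ≤ ∏_b (1 + |n_b|)`. [folklore] -/
private theorem natAbs_le_prod_one_add (n : ι → ℤ) (a : ι) :
    ((n a).natAbs : ℝ) ≤ ∏ b, (1 + ((n b).natAbs : ℝ)) := by
  classical
  calc ((n a).natAbs : ℝ) ≤ 1 + ((n a).natAbs : ℝ) := by
        linarith [Nat.cast_nonneg (α := ℝ) (n a).natAbs]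
    _ = ∏ b, (if b = a then 1 + ((n b).natAbs : ℝ) else 1) :=
        (Fintype.prod_ite_eq' a (fun b => 1 + ((n b).natAbs : ℝ))).symm
    _ ≤ ∏ b, (1 + ((n b).natAbs : ℝ)) := by
        refine Finset.prod_le_prod (fun b _ => ?_) (fun b _ => ?_)
        · split_ifs <;> positivity
        · split_ifs
          · exact le_rfl
          · linarith [Nat.cast_nonneg (α := ℝ) (n b).natAbs]

/-- `∏_b (1 + |n_b|) ≤ ∏_b (1 + |n_b|)²` (every factor is at least one). [folklore] -/
private theorem prod_one_add_le_prod_sq (n : ι → ℤ) :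
    ∏ b, (1 + ((n b).natAbs : ℝ)) ≤ ∏ b, (1 + ((n b).natAbs : ℝ)) ^ 2 := by
  refine Finset.prod_le_prod (fun b _ => by positivity) fun b _ => ?_
  have : (1 : ℝ) ≤ 1 + ((n b).natAbs : ℝ) := by linarith [Nat.cast_nonneg (α := ℝ) (n b).natAbs]
  nlinarith

/-- **Flux bound**: `|Φ_s(n)| ≤ (∑_a |s_a|) ∏_b (1 + |n_b|)` for the `s`-flux `Φ_s(n) = ∑_a s_a n_a` of an
integer current `n`. [folklore] -/
private theorem abs_flux_le (s : ι → ℝ) (n : ι → ℤ) :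
    |∑ a, s a * (n a : ℝ)| ≤ (∑ a, |s a|) * ∏ b, (1 + ((n b).natAbs : ℝ)) := by
  refine (Finset.abs_sum_le_sum_abs _ _).trans ?_
  rw [Finset.sum_mul]
  refine Finset.sum_le_sum fun a _ => ?_
  rw [abs_mul]
  refine mul_le_mul_of_nonneg_left ?_ (abs_nonneg _)
  have h := natAbs_le_prod_one_add n a
  rwa [Nat.cast_natAbs, Int.cast_abs] at h

/-- **Flux second-moment bound**: `Φ_s(n)² ≤ (∑_a |s_a|)² ∏_b (1 + |n_b|)²`. [folklore] -/
private theorem flux_sq_le (s : ι → ℝ) (n : ι → ℤ) :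
    (∑ a, s a * (n a : ℝ)) ^ 2 ≤ (∑ a, |s a|) ^ 2 * ∏ b, (1 + ((n b).natAbs : ℝ)) ^ 2 := by
  have h := abs_flux_le s n
  calc (∑ a, s a * (n a : ℝ)) ^ 2 = |∑ a, s a * (n a : ℝ)| ^ 2 := (sq_abs _).symm
    _ ≤ ((∑ a, |s a|) * ∏ b, (1 + ((n b).natAbs : ℝ))) ^ 2 := pow_le_pow_left₀ (abs_nonneg _) h 2
    _ = (∑ a, |s a|) ^ 2 * ∏ b, (1 + ((n b).natAbs : ℝ)) ^ 2 := by rw [mul_pow, Finset.prod_pow]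

/-- `|Φ_s(n)| ≤ (∑_a |s_a|) ∏_b (1 + |n_b|)²`. [folklore] -/
private theorem abs_flux_le_sq (s : ι → ℝ) (n : ι → ℤ) :
    |∑ a, s a * (n a : ℝ)| ≤ (∑ a, |s a|) * ∏ b, (1 + ((n b).natAbs : ℝ)) ^ 2 :=
  (abs_flux_le s n).trans (mul_le_mul_of_nonneg_left (prod_one_add_le_prod_sq n)
    (Finset.sum_nonneg fun _ _ => abs_nonneg _))

/-- **The moment majorant is summable over all integer currents**:
`∑_{n ∈ ℤ^ι} ∏_a I_{n_a}(|J_a|)(1 + |n_a|)² < ∞` (product of the per-bond moment series of §1).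
[cite: AbramowitzStegun1964, 9.6.10 (series of `I_ν`; termwise comparison)] -/
theorem summable_prod_besselI_mul_one_add_natAbs_sq (J : ι → ℝ) :
    Summable fun n : ι → ℤ => ∏ a, besselI (n a) |J a| * (1 + ((n a).natAbs : ℝ)) ^ 2 := by
  classical
  have h := summable_prod_norm
    (c := fun a m => ((besselI m |J a| * (1 + (m.natAbs : ℝ)) ^ 2 : ℝ) : ℂ)) fun a => by
      simp_rw [Complex.norm_real, Real.norm_eq_abs]
      have hs := summable_besselI_mul_one_add_natAbs_sq (abs_nonneg (J a))
      refine hs.congr fun m => ?_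
      rw [abs_of_nonneg (mul_nonneg (besselI_nonneg (abs_nonneg _) _) (sq_nonneg _))]
  refine h.congr fun n => Finset.prod_congr rfl fun a _ => ?_
  rw [Complex.norm_real, Real.norm_eq_abs,
    abs_of_nonneg (mul_nonneg (besselI_nonneg (abs_nonneg _) _) (sq_nonneg _))]

/-- `t ↦ e^{i t c}` has derivative `i c · e^{i t c}`. [folklore] -/
private theorem hasDerivAt_exp_mul_flux_I (c t : ℝ) :
    HasDerivAt (fun t : ℝ => Complex.exp ((((t * c : ℝ)) : ℂ) * I))
      (((c : ℝ) : ℂ) * I * Complex.exp ((((t * c : ℝ)) : ℂ) * I)) t := by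
  have h1 : HasDerivAt (fun t : ℝ => t * c) c t := by
    simpa using (hasDerivAt_id t).mul_const c
  have h2 : HasDerivAt (fun t : ℝ => (((t * c : ℝ)) : ℂ) * I) ((c : ℂ) * I) t :=
    h1.ofReal_comp.mul_const I
  exact ((Complex.hasDerivAt_exp _).comp t h2).congr_deriv (by ring)

end Flux

namespace BondSystem

variable {V ι : Type*} (G : BondSystem V ι) [Fintype ι]

/-! ## §3 The dual weights: bounds and summability -/

open Classical in
/-- The dual weight is dominated by the Bessel product at `|J|`:
`|[n closed] ∏_a I_{n_a}(J_a)| ≤ ∏_a I_{n_a}(|J_a|)` (`|I_m(x)| = I_m(|x|)`). [cite: MontvayMunster1994, §3.2.7 (3.171)–(3.172) (PDF p. 128)] -/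
theorem abs_currentWeight_le (J : ι → ℝ) (n : ι → ℤ) :
    |(if twistChar G.bondChar 1 n = 1 then ∏ a, besselI (n a) (J a) else 0 : ℝ)| ≤
      ∏ a, besselI (n a) |J a| := by
  have hmaj : ∏ a, |besselI (n a) (J a)| = ∏ a, besselI (n a) |J a| :=
    Finset.prod_congr rfl fun a _ => abs_besselI _ _
  split_ifs
  · rw [Finset.abs_prod, hmaj]
  · rw [abs_zero, ← hmaj]; exact Finset.prod_nonneg fun a _ => abs_nonneg _

open Classical in
/-- `|W(n)| ≤ ∏_a I_{n_a}(|J_a|)(1 + |n_a|)²` (the moment majorant). [cite: MontvayMunster1994, §3.2.7 (3.171)–(3.172) (PDF p. 128)] -/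
theorem abs_currentWeight_le_majorant (J : ι → ℝ) (n : ι → ℤ) :
    |(if twistChar G.bondChar 1 n = 1 then ∏ a, besselI (n a) (J a) else 0 : ℝ)| ≤
      ∏ a, besselI (n a) |J a| * (1 + ((n a).natAbs : ℝ)) ^ 2 := by
  refine (G.abs_currentWeight_le J n).trans (Finset.prod_le_prod
    (fun a _ => besselI_nonneg (abs_nonneg _) _) fun a _ => ?_)
  have h1 : (1 : ℝ) ≤ (1 + ((n a).natAbs : ℝ)) ^ 2 := by
    have : (1 : ℝ) ≤ 1 + ((n a).natAbs : ℝ) := by linarith [Nat.cast_nonneg (α := ℝ) (n a).natAbs]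
    nlinarith
  exact le_mul_of_one_le_right (besselI_nonneg (abs_nonneg _) _) h1

open Classical in
/-- **First flux moments**: `|W(n)|·|Φ_s(n)| ≤ (∑_a |s_a|) · ∏_a I_{n_a}(|J_a|)(1 + |n_a|)²`.
[cite: FrohlichSpencerCMP1982, §2.3 (duality transformation: integer currents)] -/
theorem abs_currentWeight_mul_abs_flux_le (J s : ι → ℝ) (n : ι → ℤ) :
    |(if twistChar G.bondChar 1 n = 1 then ∏ a, besselI (n a) (J a) else 0 : ℝ)| *
        |∑ a, s a * (n a : ℝ)| ≤
      (∑ a, |s a|) * ∏ a, besselI (n a) |J a| * (1 + ((n a).natAbs : ℝ)) ^ 2 := by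
  have hI : 0 ≤ ∏ a, besselI (n a) |J a| :=
    Finset.prod_nonneg fun a _ => besselI_nonneg (abs_nonneg _) _
  calc |(if twistChar G.bondChar 1 n = 1 then ∏ a, besselI (n a) (J a) else 0 : ℝ)| *
        |∑ a, s a * (n a : ℝ)|
      ≤ (∏ a, besselI (n a) |J a|) * ((∑ a, |s a|) * ∏ b, (1 + ((n b).natAbs : ℝ)) ^ 2) :=
        mul_le_mul (G.abs_currentWeight_le J n) (abs_flux_le_sq s n) (abs_nonneg _) hI
    _ = (∑ a, |s a|) * ∏ a, besselI (n a) |J a| * (1 + ((n a).natAbs : ℝ)) ^ 2 := by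
        rw [Finset.prod_mul_distrib]; ring

open Classical in
/-- **Second flux moments**: `|W(n)|·Φ_s(n)² ≤ (∑_a |s_a|)² · ∏_a I_{n_a}(|J_a|)(1 + |n_a|)²`.
[cite: FrohlichSpencerCMP1982, §2.3 (duality transformation: integer currents)] -/
theorem abs_currentWeight_mul_flux_sq_le (J s : ι → ℝ) (n : ι → ℤ) :
    |(if twistChar G.bondChar 1 n = 1 then ∏ a, besselI (n a) (J a) else 0 : ℝ)| *
        (∑ a, s a * (n a : ℝ)) ^ 2 ≤
      (∑ a, |s a|) ^ 2 * ∏ a, besselI (n a) |J a| * (1 + ((n a).natAbs : ℝ)) ^ 2 := by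
  have hI : 0 ≤ ∏ a, besselI (n a) |J a| :=
    Finset.prod_nonneg fun a _ => besselI_nonneg (abs_nonneg _) _
  calc |(if twistChar G.bondChar 1 n = 1 then ∏ a, besselI (n a) (J a) else 0 : ℝ)| *
        (∑ a, s a * (n a : ℝ)) ^ 2
      ≤ (∏ a, besselI (n a) |J a|) * ((∑ a, |s a|) ^ 2 * ∏ b, (1 + ((n b).natAbs : ℝ)) ^ 2) :=
        mul_le_mul (G.abs_currentWeight_le J n) (flux_sq_le s n) (sq_nonneg _) hI
    _ = (∑ a, |s a|) ^ 2 * ∏ a, besselI (n a) |J a| * (1 + ((n a).natAbs : ℝ)) ^ 2 := by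
        rw [Finset.prod_mul_distrib]; ring

open Classical in
/-- `∑_n |W(n)| Φ_s(n)² < ∞`. [cite: FrohlichSpencerCMP1982, §2.3 (duality transformation: integer currents)] -/
theorem summable_abs_currentWeight_mul_flux_sq (J s : ι → ℝ) :
    Summable fun n : ι → ℤ =>
      |(if twistChar G.bondChar 1 n = 1 then ∏ a, besselI (n a) (J a) else 0 : ℝ)| *
        (∑ a, s a * (n a : ℝ)) ^ 2 :=
  Summable.of_nonneg_of_le (fun _ => mul_nonneg (abs_nonneg _) (sq_nonneg _))
    (fun n => G.abs_currentWeight_mul_flux_sq_le J s n)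
    ((summable_prod_besselI_mul_one_add_natAbs_sq J).mul_left _)

open Classical in
/-- `∑_n W(n) Φ_s(n)²` converges absolutely (any real couplings). [cite: FrohlichSpencerCMP1982, §2.3 (duality transformation: integer currents)] -/
theorem summable_currentWeight_mul_flux_sq (J s : ι → ℝ) :
    Summable fun n : ι → ℤ =>
      (if twistChar G.bondChar 1 n = 1 then ∏ a, besselI (n a) (J a) else 0 : ℝ) *
        (∑ a, s a * (n a : ℝ)) ^ 2 := by
  refine (G.summable_abs_currentWeight_mul_flux_sq J s).of_norm_bounded fun n => ?_
  rw [Real.norm_eq_abs, abs_mul, abs_sq]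

open Classical in
/-- `∑_n W(n)` converges absolutely (any real couplings). [cite: FrohlichSpencerCMP1982, §2.3 (duality transformation: integer currents)] -/
theorem summable_currentWeight (J : ι → ℝ) :
    Summable fun n : ι → ℤ =>
      (if twistChar G.bondChar 1 n = 1 then ∏ a, besselI (n a) (J a) else 0 : ℝ) := by
  refine Summable.of_norm_bounded (summable_prod_besselI_mul_one_add_natAbs_sq J) fun n => ?_
  rw [Real.norm_eq_abs]
  exact G.abs_currentWeight_le_majorant J n

/-! ## §4 `Z(t) = ∑_n W(n) e^{itΦ_s(n)}`: termwise differentiation -/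

omit [Fintype ι] in
/-- `‖e^{i x}‖ = 1` for the current phases. [folklore] -/
private theorem norm_exp_flux (x : ℝ) : ‖Complex.exp (((x : ℝ) : ℂ) * I)‖ = 1 :=
  Complex.norm_exp_ofReal_mul_I x

open Classical in
/-- Summability of the current sum at every `t` (`|W(n) e^{itΦ}| = |W(n)|`). [cite: FrohlichSpencerCMP1982, §2.3 (duality transformation)] -/
theorem summable_currentWeight_mul_exp (J s : ι → ℝ) (t : ℝ) :
    Summable fun n : ι → ℤ =>
      ((if twistChar G.bondChar 1 n = 1 then ∏ a, besselI (n a) (J a) else 0 : ℝ) : ℂ) *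
        Complex.exp (((t * ∑ a, s a * (n a : ℝ) : ℝ) : ℂ) * I) := by
  refine Summable.of_norm_bounded (summable_prod_besselI_mul_one_add_natAbs_sq J) fun n => ?_
  rw [norm_mul, norm_exp_flux, mul_one, Complex.norm_real, Real.norm_eq_abs]
  exact G.abs_currentWeight_le_majorant J n

open Classical in
/-- **First termwise differentiation**: `t ↦ ∑_n W(n) e^{itΦ_s(n)}` has derivative
`∑_n W(n) · iΦ_s(n) · e^{itΦ_s(n)}` (derivative bounds `|W(n)|·|Φ_s(n)|`, summable by §3; Mathlib
`hasDerivAt_tsum`). [cite: FrohlichSpencerCMP1982, §2.3 (duality transformation: integer currents)] -/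
theorem hasDerivAt_tsum_currentWeight_mul_exp (J s : ι → ℝ) (t : ℝ) :
    HasDerivAt (fun t : ℝ => ∑' n : ι → ℤ,
        ((if twistChar G.bondChar 1 n = 1 then ∏ a, besselI (n a) (J a) else 0 : ℝ) : ℂ) *
          Complex.exp (((t * ∑ a, s a * (n a : ℝ) : ℝ) : ℂ) * I))
      (∑' n : ι → ℤ,
        ((if twistChar G.bondChar 1 n = 1 then ∏ a, besselI (n a) (J a) else 0 : ℝ) : ℂ) *
          ((((∑ a, s a * (n a : ℝ) : ℝ)) : ℂ) * I *
            Complex.exp (((t * ∑ a, s a * (n a : ℝ) : ℝ) : ℂ) * I))) t := by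
  refine hasDerivAt_tsum
    (g := fun (n : ι → ℤ) (t : ℝ) =>
      ((if twistChar G.bondChar 1 n = 1 then ∏ a, besselI (n a) (J a) else 0 : ℝ) : ℂ) *
        Complex.exp (((t * ∑ a, s a * (n a : ℝ) : ℝ) : ℂ) * I))
    (g' := fun (n : ι → ℤ) (t : ℝ) =>
      ((if twistChar G.bondChar 1 n = 1 then ∏ a, besselI (n a) (J a) else 0 : ℝ) : ℂ) *
        ((((∑ a, s a * (n a : ℝ) : ℝ)) : ℂ) * I *
          Complex.exp (((t * ∑ a, s a * (n a : ℝ) : ℝ) : ℂ) * I)))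
    ((summable_prod_besselI_mul_one_add_natAbs_sq J).mul_left (∑ a, |s a|))
    (fun n t => ?_) (fun n t => ?_) (G.summable_currentWeight_mul_exp J s 0) t
  · exact (hasDerivAt_exp_mul_flux_I _ t).const_mul _
  · refine le_of_eq_of_le ?_ (G.abs_currentWeight_mul_abs_flux_le J s n)
    simp only [norm_mul, norm_exp_flux, Complex.norm_I, mul_one, Complex.norm_real, Real.norm_eq_abs]

open Classical in
/-- **Second termwise differentiation**: `t ↦ ∑_n W(n) iΦ e^{itΦ}` has derivative
`∑_n W(n) (iΦ)(iΦ) e^{itΦ} = −∑_n W(n) Φ_s(n)² e^{itΦ_s(n)}` (derivative bounds `|W(n)| Φ_s(n)²`).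
[cite: FrohlichSpencerCMP1982, §2.3 (duality transformation: integer currents)] -/
theorem hasDerivAt_tsum_currentWeight_mul_flux_mul_exp (J s : ι → ℝ) (t : ℝ) :
    HasDerivAt (fun t : ℝ => ∑' n : ι → ℤ,
        ((if twistChar G.bondChar 1 n = 1 then ∏ a, besselI (n a) (J a) else 0 : ℝ) : ℂ) *
          ((((∑ a, s a * (n a : ℝ) : ℝ)) : ℂ) * I *
            Complex.exp (((t * ∑ a, s a * (n a : ℝ) : ℝ) : ℂ) * I)))
      (∑' n : ι → ℤ,
        ((if twistChar G.bondChar 1 n = 1 then ∏ a, besselI (n a) (J a) else 0 : ℝ) : ℂ) *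
          ((((∑ a, s a * (n a : ℝ) : ℝ)) : ℂ) * I * ((((∑ a, s a * (n a : ℝ) : ℝ)) : ℂ) * I *
            Complex.exp (((t * ∑ a, s a * (n a : ℝ) : ℝ) : ℂ) * I)))) t := by
  refine hasDerivAt_tsum
    (g := fun (n : ι → ℤ) (t : ℝ) =>
      ((if twistChar G.bondChar 1 n = 1 then ∏ a, besselI (n a) (J a) else 0 : ℝ) : ℂ) *
        ((((∑ a, s a * (n a : ℝ) : ℝ)) : ℂ) * I *
          Complex.exp (((t * ∑ a, s a * (n a : ℝ) : ℝ) : ℂ) * I)))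
    (g' := fun (n : ι → ℤ) (t : ℝ) =>
      ((if twistChar G.bondChar 1 n = 1 then ∏ a, besselI (n a) (J a) else 0 : ℝ) : ℂ) *
        ((((∑ a, s a * (n a : ℝ) : ℝ)) : ℂ) * I * ((((∑ a, s a * (n a : ℝ) : ℝ)) : ℂ) * I *
          Complex.exp (((t * ∑ a, s a * (n a : ℝ) : ℝ) : ℂ) * I))))
    (y₀ := 0)
    ((summable_prod_besselI_mul_one_add_natAbs_sq J).mul_left ((∑ a, |s a|) ^ 2))
    (fun n t => ?_) (fun n t => ?_) ?_ t
  · exact ((hasDerivAt_exp_mul_flux_I _ t).const_mul _).const_mul _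
  · refine le_of_eq_of_le ?_ (G.abs_currentWeight_mul_flux_sq_le J s n)
    simp only [norm_mul, norm_exp_flux, Complex.norm_I, mul_one, Complex.norm_real, Real.norm_eq_abs]
    rw [← sq_abs (∑ a, s a * (n a : ℝ)), sq]
  · refine Summable.of_norm_bounded
      ((summable_prod_besselI_mul_one_add_natAbs_sq J).mul_left (∑ a, |s a|)) fun n => ?_
    refine le_of_eq_of_le ?_ (G.abs_currentWeight_mul_abs_flux_le J s n)
    simp only [norm_mul, norm_exp_flux, Complex.norm_I, mul_one, Complex.norm_real, Real.norm_eq_abs]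

/-! ## §5 Identification with `Z`, `Z'`, `Z''` -/

variable [Fintype V] [MeasurableSpace Circle] [BorelSpace Circle]

open Classical in
/-- The character expansion of the twisted partition function as an exponential sum over currents:
`Z(t) = ∑_n [n closed] ∏_a I_{n_a}(J_a) · e^{i t Φ_s(n)}` (the bond phases `∏_a (e^{its_a})^{n_a}`
assemble into `e^{it ∑_a s_a n_a}`). [cite: FrohlichSpencerCMP1982, §2.3 (duality transformation: integer currents); FisherBarberJasnow1973 §II eqs. (2.3)–(2.5)] -/
theorem coe_twistPartitionFn_eq_tsum_exp (J s : ι → ℝ) (t : ℝ) :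
    ((G.twistPartitionFn J s t : ℝ) : ℂ) =
      ∑' n : ι → ℤ, ((if twistChar G.bondChar 1 n = 1 then ∏ a, besselI (n a) (J a) else 0 : ℝ) : ℂ) *
        Complex.exp (((t * ∑ a, s a * (n a : ℝ) : ℝ) : ℂ) * I) := by
  rw [G.coe_twistPartitionFn_eq_tsum J s t]
  refine tsum_congr fun n => ?_
  split_ifs with h
  · have hexp : ∀ a, (((twistPhases s t a : Circle) : ℂ)) ^ (n a) =
        Complex.exp ((n a : ℂ) * ((((t * s a : ℝ)) : ℂ) * I)) := fun a => by
      rw [Complex.exp_int_mul]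
      rfl
    have hsum : ∑ a, (n a : ℂ) * ((((t * s a : ℝ)) : ℂ) * I) =
        (((t * ∑ a, s a * (n a : ℝ) : ℝ)) : ℂ) * I := by
      push_cast
      rw [Finset.mul_sum, Finset.sum_mul]
      exact Finset.sum_congr rfl fun a _ => by ring
    simp_rw [hexp]
    rw [Finset.prod_mul_distrib, ← Complex.exp_sum, Complex.ofReal_prod, hsum]
  · simp


open Classical in
/-- **`Z'(t)` in the dual variables**: `Z'(t) = ∑_n W(n) · iΦ_s(n) · e^{itΦ_s(n)}` (uniqueness of the
derivative: the tree's `hasDerivAt_twistPartitionFn` against the termwise derivative of §4).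
[cite: FrohlichSpencerCMP1982, §2.3 (duality transformation: integer currents); FisherBarberJasnow1973 §II eqs. (2.4)–(2.5)] -/
theorem coe_twistPartitionFnDeriv_eq_tsum (J s : ι → ℝ) (t : ℝ) :
    ((G.twistPartitionFnDeriv J s t : ℝ) : ℂ) =
      ∑' n : ι → ℤ, ((if twistChar G.bondChar 1 n = 1 then ∏ a, besselI (n a) (J a) else 0 : ℝ) : ℂ) *
        ((((∑ a, s a * (n a : ℝ) : ℝ)) : ℂ) * I *
          Complex.exp (((t * ∑ a, s a * (n a : ℝ) : ℝ) : ℂ) * I)) := by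
  have h1 : HasDerivAt (fun t => ((G.twistPartitionFn J s t : ℝ) : ℂ))
      ((G.twistPartitionFnDeriv J s t : ℝ) : ℂ) t :=
    (G.hasDerivAt_twistPartitionFn J s t).ofReal_comp
  have hfun : (fun t => ((G.twistPartitionFn J s t : ℝ) : ℂ)) = fun t : ℝ => ∑' n : ι → ℤ,
      ((if twistChar G.bondChar 1 n = 1 then ∏ a, besselI (n a) (J a) else 0 : ℝ) : ℂ) *
        Complex.exp (((t * ∑ a, s a * (n a : ℝ) : ℝ) : ℂ) * I) :=
    funext fun t => G.coe_twistPartitionFn_eq_tsum_exp J s t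
  rw [hfun] at h1
  exact h1.unique (G.hasDerivAt_tsum_currentWeight_mul_exp J s t)

open Classical in
/-- **`Z''(t)` in the dual variables**: `Z''(t) = ∑_n W(n) (iΦ_s(n))² e^{itΦ_s(n)}`.
[cite: FrohlichSpencerCMP1982, §2.3 (duality transformation: integer currents); FisherBarberJasnow1973 §II eqs. (2.4)–(2.5)] -/
theorem coe_twistPartitionFnDeriv2_eq_tsum (J s : ι → ℝ) (t : ℝ) :
    ((G.twistPartitionFnDeriv2 J s t : ℝ) : ℂ) =
      ∑' n : ι → ℤ, ((if twistChar G.bondChar 1 n = 1 then ∏ a, besselI (n a) (J a) else 0 : ℝ) : ℂ) *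
        ((((∑ a, s a * (n a : ℝ) : ℝ)) : ℂ) * I * ((((∑ a, s a * (n a : ℝ) : ℝ)) : ℂ) * I *
          Complex.exp (((t * ∑ a, s a * (n a : ℝ) : ℝ) : ℂ) * I))) := by
  have h1 : HasDerivAt (fun t => ((G.twistPartitionFnDeriv J s t : ℝ) : ℂ))
      ((G.twistPartitionFnDeriv2 J s t : ℝ) : ℂ) t :=
    (G.hasDerivAt_twistPartitionFnDeriv J s t).ofReal_comp
  have hfun : (fun t => ((G.twistPartitionFnDeriv J s t : ℝ) : ℂ)) = fun t : ℝ => ∑' n : ι → ℤ,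
      ((if twistChar G.bondChar 1 n = 1 then ∏ a, besselI (n a) (J a) else 0 : ℝ) : ℂ) *
        ((((∑ a, s a * (n a : ℝ) : ℝ)) : ℂ) * I *
          Complex.exp (((t * ∑ a, s a * (n a : ℝ) : ℝ) : ℂ) * I)) :=
    funext fun t => G.coe_twistPartitionFnDeriv_eq_tsum J s t
  rw [hfun] at h1
  exact h1.unique (G.hasDerivAt_tsum_currentWeight_mul_flux_mul_exp J s t)

open Classical in
/-- **`Z''(0) = −∑_n W(n) Φ_s(n)²`**: the curvature of the twisted partition function at zero twist is
minus the second flux moment of the dual weights. [cite: FrohlichSpencerCMP1982, §2.3 (duality transformation: integer currents); FisherBarberJasnow1973 §II eqs. (2.4)–(2.5)] -/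
theorem twistPartitionFnDeriv2_zero_eq_neg_tsum (J s : ι → ℝ) :
    G.twistPartitionFnDeriv2 J s 0 =
      -∑' n : ι → ℤ, (if twistChar G.bondChar 1 n = 1 then ∏ a, besselI (n a) (J a) else 0 : ℝ) *
        (∑ a, s a * (n a : ℝ)) ^ 2 := by
  have h := G.coe_twistPartitionFnDeriv2_eq_tsum J s 0
  have hterm : ∀ n : ι → ℤ,
      ((if twistChar G.bondChar 1 n = 1 then ∏ a, besselI (n a) (J a) else 0 : ℝ) : ℂ) *
        ((((∑ a, s a * (n a : ℝ) : ℝ)) : ℂ) * I * ((((∑ a, s a * (n a : ℝ) : ℝ)) : ℂ) * I *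
          Complex.exp ((((0 : ℝ) * ∑ a, s a * (n a : ℝ) : ℝ) : ℂ) * I))) =
      ((-((if twistChar G.bondChar 1 n = 1 then ∏ a, besselI (n a) (J a) else 0 : ℝ) *
        (∑ a, s a * (n a : ℝ)) ^ 2) : ℝ) : ℂ) := fun n => by
    set W : ℝ := (if twistChar G.bondChar 1 n = 1 then ∏ a, besselI (n a) (J a) else 0) with hW
    set Φ : ℝ := ∑ a, s a * (n a : ℝ) with hΦ
    rw [zero_mul, Complex.ofReal_zero, zero_mul, Complex.exp_zero, mul_one, Complex.ofReal_neg,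
      Complex.ofReal_mul, Complex.ofReal_pow]
    have hI : I * I = -1 := Complex.I_mul_I
    linear_combination ((W : ℂ) * (Φ : ℂ) ^ 2) * hI
  simp_rw [hterm] at h
  rw [← Complex.ofReal_tsum, tsum_neg] at h
  exact_mod_cast h

open Classical in
/-- **The dual formula for the helicity modulus** (any real couplings):
`twistModulus · Z(J) = ∑_n [n closed] ∏_a I_{n_a}(J_a) · Φ_s(n)²`, i.e.
`(−log Z)''(0) = −Z''(0)/Z(0)` (since `Z'(0) = 0`) is the `Z`-normalised second flux moment of the
dual weights. [cite: FrohlichPfister1983, Lemma 3.1 and Remark (pp. 307–308: the twist free energy and the vortex winding energy); FrohlichSpencerCMP1982 §2.3] -/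
theorem twistModulus_mul_partitionFnJ_eq_tsum (J s : ι → ℝ) :
    G.twistModulus J s * G.partitionFnJ J =
      ∑' n : ι → ℤ, (if twistChar G.bondChar 1 n = 1 then ∏ a, besselI (n a) (J a) else 0 : ℝ) *
        (∑ a, s a * (n a : ℝ)) ^ 2 := by
  have hZ := G.partitionFnJ_pos J
  have hD := (G.hasDerivAt_twistFreeEnergyDeriv_zero J s).unique
    (G.hasDerivAt_twistFreeEnergyDeriv J s 0)
  rw [twistPartitionFn_zero, G.twistPartitionFnDeriv_zero_eq_zero J s,
    G.twistPartitionFnDeriv2_zero_eq_neg_tsum J s] at hD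
  rw [hD]
  field_simp
  ring

open Classical in
/-- The partition function in the dual variables: `Z(J) = ∑_n [n closed] ∏_a I_{n_a}(J_a)` (tree
`integral_ginibreWeight_eq_tsum` for the bond characters). [cite: FrohlichSpencerCMP1982, §2.3 (duality transformation); MontvayMunster1994 §3.2.7 (3.169)–(3.172)] -/
theorem partitionFnJ_eq_tsum_currentWeight (J : ι → ℝ) :
    G.partitionFnJ J = ∑' n : ι → ℤ, (if twistChar G.bondChar 1 n = 1 then ∏ a, besselI (n a) (J a) else 0 : ℝ) :=
  integral_ginibreWeight_eq_tsum (torusHaar V) G.bondChar J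

open Classical in
/-- **`twistModulus = ⟨Φ_s²⟩_W`**: `(−log Z)''(0) = (∑_n W(n) Φ_s(n)²)/(∑_n W(n))` — for ferromagnetic
couplings (`W ≥ 0`) the helicity modulus is the MEAN-SQUARE `s`-FLUX of the dual ensemble of
divergence-free integer currents `P(n) ∝ ∏_a I_{n_a}(J_a)`. [cite: FrohlichPfister1983, Lemma 3.1 and Remark (pp. 307–308); FrohlichSpencerCMP1982 §2.3] -/
theorem twistModulus_eq_tsum_div_tsum (J s : ι → ℝ) :
    G.twistModulus J s =
      (∑' n : ι → ℤ, (if twistChar G.bondChar 1 n = 1 then ∏ a, besselI (n a) (J a) else 0 : ℝ) *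
          (∑ a, s a * (n a : ℝ)) ^ 2) /
        ∑' n : ι → ℤ, (if twistChar G.bondChar 1 n = 1 then ∏ a, besselI (n a) (J a) else 0 : ℝ) := by
  rw [← G.partitionFnJ_eq_tsum_currentWeight J, eq_div_iff (G.partitionFnJ_pos J).ne']
  exact G.twistModulus_mul_partitionFnJ_eq_tsum J s

end BondSystem

/-! ## §6 The torus `(ℤ/Lℤ)²`: `βΥ_L · L² · Z_L = ∑_n W(n) (∑_{e₁-bonds} n_b)²` -/

section Torus

variable {L : ℕ} [NeZero L] [MeasurableSpace Circle] [BorelSpace Circle]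

omit [MeasurableSpace Circle] [BorelSpace Circle] in
/-- The `e₁`-flux of a current on the torus: `∑_b s_b n_b = ∑_{b : b.2 = 0} n_b` for the twist
profile along `e₁`. [cite: FisherBarberJasnow1973, §II eqs. (2.3)–(2.5) (uniform twist)] -/
theorem sum_torusTwistProfile_mul (n : TorusSite 2 L × Fin 2 → ℤ) :
    ∑ b, torusTwistProfile L b * (n b : ℝ) = ∑ b ∈ Finset.univ.filter (fun b => b.2 = 0), (n b : ℝ) := by
  rw [Finset.sum_filter]
  exact Finset.sum_congr rfl fun b _ => by simp [torusTwistProfile]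

open Classical in
/-- **The reduced helicity modulus of the torus as a winding fluctuation**:
`βΥ_L(K) · L² · Z_L(K) = ∑_n [n closed] ∏_b I_{n_b}(K) · (∑_{e₁-bonds} n_b)²` — on `(ℤ/Lℤ)²` the
`e₁`-flux of a closed current is `L` times its winding number around the `e₁`-cycle, so `βΥ_L` is the
mean-square winding of the dual current ensemble (the classical twin of the winding-number estimator
of the superfluid density). [cite: FrohlichPfister1983, Lemma 3.1 and Remark (pp. 307–308); FisherBarberJasnow1973 §II eqs. (2.4)–(2.5)] -/
theorem torusXYStiffness_mul_card_mul_partitionFnJ_eq_tsum (K : ℝ) :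
    torusXYStiffness L K * Fintype.card (TorusSite 2 L) * (torusXY 2 L).partitionFnJ (fun _ => K) =
      ∑' n : TorusSite 2 L × Fin 2 → ℤ,
        (if twistChar (torusXY 2 L).bondChar 1 n = 1 then ∏ b, besselI (n b) K else 0 : ℝ) *
          (∑ b ∈ Finset.univ.filter (fun b => b.2 = 0), (n b : ℝ)) ^ 2 := by
  have hcard : (0 : ℝ) < Fintype.card (TorusSite 2 L) := Nat.cast_pos.2 Fintype.card_pos
  rw [torusXYStiffness, div_mul_cancel₀ _ hcard.ne']
  rw [(torusXY 2 L).twistModulus_mul_partitionFnJ_eq_tsum (fun _ => K) (torusTwistProfile L)]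
  exact tsum_congr fun n => by rw [sum_torusTwistProfile_mul]

end Torus

/-! ## §7 The torus `(ℤ/Lℤ)²`: the `e₁`-flux of a closed current is `L ×` its winding number -/

section Winding

variable {L : ℕ} [NeZero L]

/-- `diffChar X X` is the trivial character. [folklore] -/
private theorem diffChar_self {V : Type*} (X : V) : diffChar X X = (1 : (V → Circle) →ₜ* Circle) := by
  ext θ
  simp [diffChar_apply]

/-- **Kirchhoff's law for closed currents on the torus**: if the twisted character of `n` is trivial
(`∏_b χ_b^{n_b} = 1`), then at every site `v` of `(ℤ/Lℤ)²` the inflow equals the outflow: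
`∑_b ([tgt b = v] − [src b = v]) n_b = 0` (tree `BondSystem.twistChar_bondChar_diffChar_eq_one_iff`).
[cite: FrohlichSpencerCMP1982, §2.3 (duality transformation: divergence-free integer currents)] -/
theorem torusXY_kirchhoff {n : TorusSite 2 L × Fin 2 → ℤ}
    (hn : twistChar (torusXY 2 L).bondChar 1 n = 1) (v : TorusSite 2 L) :
    ∑ b : TorusSite 2 L × Fin 2,
      ((if b.1 + Pi.single b.2 1 = v then (1 : ℤ) else 0) - (if b.1 = v then 1 else 0)) * n b = 0 := by
  classical
  have hsrc : ∀ b : TorusSite 2 L × Fin 2, (torusXY 2 L).src b = b.1 := fun _ => rfl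
  have htgt : ∀ b : TorusSite 2 L × Fin 2, (torusXY 2 L).tgt b = b.1 + Pi.single b.2 1 := fun _ => rfl
  have hn' : twistChar (fun a => (torusXY 2 L).bondChar a) (diffChar (0 : TorusSite 2 L) 0) n = 1 := by
    rw [diffChar_self]; exact hn
  have h := ((torusXY 2 L).twistChar_bondChar_diffChar_eq_one_iff (0 : TorusSite 2 L) 0 n).1 hn' v
  simp only [hsrc, htgt, sub_self, zero_add] at h
  exact h

/-- **Cut independence of the flux**: for a closed current `n` on `(ℤ/Lℤ)²` the flux
`w_j(n) = ∑_{v : v₀ = j} n_{(v, e₁)}` through the vertical cut between the columns `j` and `j + 1`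
does not depend on `j`: `w_{j+1}(n) = w_j(n)` (sum Kirchhoff's law over the column `j + 1`; the
`e₂`-bonds inside the column cancel). [cite: FrohlichSpencerCMP1982, §2.3 (duality transformation: divergence-free integer currents)] -/
theorem torusXY_cutFlux_succ {n : TorusSite 2 L × Fin 2 → ℤ}
    (hn : twistChar (torusXY 2 L).bondChar 1 n = 1) (j : ZMod L) :
    (∑ v : TorusSite 2 L, if v 0 = j + 1 then n (v, 0) else 0) =
      ∑ v : TorusSite 2 L, if v 0 = j then n (v, 0) else 0 := by
  classical
  -- Kirchhoff summed over the column `j + 1`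
  have h0 : ∑ v : TorusSite 2 L, (if v 0 = j + 1 then (1 : ℤ) else 0) *
      ∑ b : TorusSite 2 L × Fin 2,
        ((if b.1 + Pi.single b.2 1 = v then (1 : ℤ) else 0) - (if b.1 = v then 1 else 0)) * n b = 0 :=
    Finset.sum_eq_zero fun v _ => by rw [torusXY_kirchhoff hn v, mul_zero]
  -- exchange the sums and evaluate the `v`-sums
  have hswap : ∑ v : TorusSite 2 L, (if v 0 = j + 1 then (1 : ℤ) else 0) *
      ∑ b : TorusSite 2 L × Fin 2,
        ((if b.1 + Pi.single b.2 1 = v then (1 : ℤ) else 0) - (if b.1 = v then 1 else 0)) * n b =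
      ∑ b : TorusSite 2 L × Fin 2, ((if (b.1 + Pi.single b.2 1 : TorusSite 2 L) 0 = j + 1 then (1 : ℤ) else 0) -
        (if b.1 0 = j + 1 then 1 else 0)) * n b := by
    simp_rw [Finset.mul_sum]
    rw [Finset.sum_comm]
    refine Finset.sum_congr rfl fun b _ => ?_
    have h1 : ∑ v : TorusSite 2 L, (if v 0 = j + 1 then (1 : ℤ) else 0) *
        (if b.1 + Pi.single b.2 1 = v then (1 : ℤ) else 0) =
        if (b.1 + Pi.single b.2 1 : TorusSite 2 L) 0 = j + 1 then 1 else 0 := by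
      simp_rw [mul_ite, mul_one, mul_zero]
      rw [Finset.sum_ite_eq, if_pos (Finset.mem_univ _)]
    have h2 : ∑ v : TorusSite 2 L, (if v 0 = j + 1 then (1 : ℤ) else 0) * (if b.1 = v then (1 : ℤ) else 0) =
        if b.1 0 = j + 1 then 1 else 0 := by
      simp_rw [mul_ite, mul_one, mul_zero]
      rw [Finset.sum_ite_eq, if_pos (Finset.mem_univ _)]
    calc ∑ v : TorusSite 2 L, (if v 0 = j + 1 then (1 : ℤ) else 0) *
          (((if b.1 + Pi.single b.2 1 = v then (1 : ℤ) else 0) - (if b.1 = v then 1 else 0)) * n b)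
        = (∑ v : TorusSite 2 L, ((if v 0 = j + 1 then (1 : ℤ) else 0) *
            (if b.1 + Pi.single b.2 1 = v then (1 : ℤ) else 0) -
            (if v 0 = j + 1 then (1 : ℤ) else 0) * (if b.1 = v then (1 : ℤ) else 0))) * n b := by
          rw [Finset.sum_mul]; exact Finset.sum_congr rfl fun v _ => by ring
      _ = _ := by rw [Finset.sum_sub_distrib, h1, h2]
  rw [hswap, Fintype.sum_prod_type] at h0
  simp only [Fin.sum_univ_two] at h0
  -- direction `e₂` terms cancel, direction `e₁`: `(v + e₁) 0 = v 0 + 1`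
  have he1 : ∀ v : TorusSite 2 L, (v + Pi.single (0 : Fin 2) (1 : ZMod L) : TorusSite 2 L) 0 = v 0 + 1 := fun v => by
    simp
  have he2 : ∀ v : TorusSite 2 L, (v + Pi.single (1 : Fin 2) (1 : ZMod L) : TorusSite 2 L) 0 = v 0 := fun v => by
    simp
  simp only [he1, he2, sub_self, zero_mul, add_zero] at h0
  have hiff : ∀ v : TorusSite 2 L, (v 0 + 1 = j + 1) = (v 0 = j) := fun v => by
    rw [add_left_inj]
  simp only [hiff, sub_mul, Finset.sum_sub_distrib, ite_mul, one_mul, zero_mul, sub_eq_zero] at h0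
  exact h0.symm

/-- All vertical cuts carry the same flux: `w_j(n) = w_0(n)`. [cite: FrohlichSpencerCMP1982, §2.3 (duality transformation: divergence-free integer currents)] -/
theorem torusXY_cutFlux_eq {n : TorusSite 2 L × Fin 2 → ℤ}
    (hn : twistChar (torusXY 2 L).bondChar 1 n = 1) (j : ZMod L) :
    (∑ v : TorusSite 2 L, if v 0 = j then n (v, 0) else 0) =
      ∑ v : TorusSite 2 L, if v 0 = 0 then n (v, 0) else 0 := by
  have hk : ∀ k : ℕ, (∑ v : TorusSite 2 L, if v 0 = (k : ZMod L) then n (v, 0) else 0) =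
      ∑ v : TorusSite 2 L, if v 0 = 0 then n (v, 0) else 0 := by
    intro k
    induction k with
    | zero => simp
    | succ k ih => rw [Nat.cast_succ, torusXY_cutFlux_succ hn, ih]
  rw [← ZMod.natCast_zmod_val j]
  exact hk j.val

/-- **The `e₁`-flux of a closed current is `L` times its winding number**:
`∑_{e₁-bonds} n_b = L · w_j(n)` for every cut `j` (the `e₁`-bonds are the disjoint union of the `L`
vertical cuts, each carrying the same flux). [cite: FrohlichSpencerCMP1982, §2.3 (duality transformation: divergence-free integer currents)] -/
theorem torusXY_sum_dir0_eq_card_mul_cutFlux {n : TorusSite 2 L × Fin 2 → ℤ}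
    (hn : twistChar (torusXY 2 L).bondChar 1 n = 1) (j : ZMod L) :
    ∑ b ∈ Finset.univ.filter (fun b : TorusSite 2 L × Fin 2 => b.2 = 0), n b =
      (L : ℤ) * ∑ v : TorusSite 2 L, if v 0 = j then n (v, 0) else 0 := by
  classical
  have h1 : ∑ b ∈ Finset.univ.filter (fun b : TorusSite 2 L × Fin 2 => b.2 = 0), n b =
      ∑ v : TorusSite 2 L, n (v, 0) := by
    rw [Finset.sum_filter, Fintype.sum_prod_type]
    simp
  have h2 : ∑ v : TorusSite 2 L, n (v, 0) =
      ∑ j' : ZMod L, ∑ v : TorusSite 2 L, if v 0 = j' then n (v, 0) else 0 := by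
    rw [Finset.sum_comm]
    refine Finset.sum_congr rfl fun v _ => ?_
    rw [Finset.sum_ite_eq, if_pos (Finset.mem_univ _)]
  rw [h1, h2, Finset.sum_congr rfl fun j' _ => (torusXY_cutFlux_eq hn j').trans (torusXY_cutFlux_eq hn j).symm,
    Finset.sum_const, Finset.card_univ, ZMod.card, nsmul_eq_mul]

variable [MeasurableSpace Circle] [BorelSpace Circle]

open Classical in
/-- **The helicity modulus is the winding-number variance of the dual current ensemble**:
for the plane rotator on `(ℤ/Lℤ)²` at coupling `K` and every vertical cut `j`,
`βΥ_L(K) · Z_L(K) = ∑_{n closed} ∏_b I_{n_b}(K) · w_j(n)²`, `w_j(n) = ∑_{v : v₀ = j} n_{(v,e₁)}` the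
flux of `n` through the cut (= its winding number around the `e₁`-cycle); for `K ≥ 0` the weights are
nonnegative and `βΥ_L = ⟨w²⟩` — the classical twin of the winding-number estimator of the superfluid
density, and the object behind Fröhlich–Pfister's remark on the vortex winding energy.
[cite: FrohlichPfister1983, Lemma 3.1 and Remark (pp. 307–308); FisherBarberJasnow1973 §II eqs. (2.4)–(2.5)] -/
theorem torusXYStiffness_mul_partitionFnJ_eq_tsum_winding (K : ℝ) (j : ZMod L) :
    torusXYStiffness L K * (torusXY 2 L).partitionFnJ (fun _ => K) =
      ∑' n : TorusSite 2 L × Fin 2 → ℤ,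
        (if twistChar (torusXY 2 L).bondChar 1 n = 1 then ∏ b, besselI (n b) K else 0 : ℝ) *
          ((∑ v : TorusSite 2 L, if v 0 = j then n (v, 0) else 0 : ℤ) : ℝ) ^ 2 := by
  have hL : (L : ℝ) ≠ 0 := Nat.cast_ne_zero.2 (NeZero.ne L)
  have hcard : (Fintype.card (TorusSite 2 L) : ℝ) = (L : ℝ) ^ 2 := by
    rw [Fintype.card_fun, ZMod.card, Fintype.card_fin]; push_cast; ring
  have h := torusXYStiffness_mul_card_mul_partitionFnJ_eq_tsum (L := L) K
  have hterm : ∀ n : TorusSite 2 L × Fin 2 → ℤ,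
      (if twistChar (torusXY 2 L).bondChar 1 n = 1 then ∏ b, besselI (n b) K else 0 : ℝ) *
          (∑ b ∈ Finset.univ.filter (fun b : TorusSite 2 L × Fin 2 => b.2 = 0), (n b : ℝ)) ^ 2 =
        (L : ℝ) ^ 2 * ((if twistChar (torusXY 2 L).bondChar 1 n = 1 then ∏ b, besselI (n b) K else 0 : ℝ) *
          ((∑ v : TorusSite 2 L, if v 0 = j then n (v, 0) else 0 : ℤ) : ℝ) ^ 2) := fun n => by
    by_cases hn : twistChar (torusXY 2 L).bondChar 1 n = 1
    · have hflux := torusXY_sum_dir0_eq_card_mul_cutFlux hn j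
      have hcast : (∑ b ∈ Finset.univ.filter (fun b : TorusSite 2 L × Fin 2 => b.2 = 0), (n b : ℝ)) =
          ((∑ b ∈ Finset.univ.filter (fun b : TorusSite 2 L × Fin 2 => b.2 = 0), n b : ℤ) : ℝ) := by
        push_cast; rfl
      rw [hcast, hflux]
      push_cast
      ring
    · simp [hn]
  simp_rw [hterm] at h
  rw [tsum_mul_left, hcard] at h
  have h' : (L : ℝ) ^ 2 * (torusXYStiffness L K * (torusXY 2 L).partitionFnJ (fun _ => K)) =
      (L : ℝ) ^ 2 * ∑' n : TorusSite 2 L × Fin 2 → ℤ,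
        (if twistChar (torusXY 2 L).bondChar 1 n = 1 then ∏ b, besselI (n b) K else 0 : ℝ) *
          ((∑ v : TorusSite 2 L, if v 0 = j then n (v, 0) else 0 : ℤ) : ℝ) ^ 2 := by
    rw [← h]; ring
  exact mul_left_cancel₀ (pow_ne_zero 2 hL) h'

end Winding

end Literature.Probability.LatticeModels
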